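import Summits.BirchSwinnertonDyer.BirchSwinnertonDyer.Theorems.ByReductionTypeAtTwoFineSelmerConjAAtTwoAdditivePotGoodCapitulationCertificate
import Summits.BirchSwinnertonDyer.BirchSwinnertonDyer.Theorems.ByReductionTypeAtTwoFineSelmerConjAAtTwoAdditivePotGoodFukudaRowStampsE
import HarnessLib

/-!
# Route `ByReductionTypeAtTwo` (rung K4), crux C1″ `FineSelmerConjAAtTwoAdditivePotGood` (item stmt-BirchSwinnertonDyer-22615):
# CAPITULATION CERTIFICATE for the census row `98592q1` (cubic `2`-torsion point field of discriminant `-4108`, EVEN class number):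
# the displayed hypothesis `e₁ = e₀` of `conjA_two_98592q1_of_fukudaLayers` DISCHARGED — (A)₂ for `98592q1` modulo `hLim2` ALONE
# (a `--supports 22615` file; seat `bsd-2adic-k4-w1` GEN 7; consumer of `…CapitulationCertificate` and `…ClassGroupCyclicCriterion`)

HONEST FRAMING (cell `bsd-2adic`, D-0036/D-0054/D-0152): a per-class stamp, conditional on `hLim2` (Lim 2017 Thm. 3.5 at `2`) BY NAME and on
nothing else; the former displayed numeric equality `ord₂ h(ℚ(θ, √2)) = ord₂ h(ℚ(θ))` (census/PARI) is now KERNEL. Closes nothing at the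
`∀`-level; nothing booked; BSD is not proved by any of this.

THE CERTIFICATE (`K = ℚ(θ)`, `θ³ + (0)θ² + (10)θ + (-2) = 0`, `K₁ = K(s)`, `s² = 2`):
* K-SIDE (`zpowers_mk0_eq_top_d4108n`): `Cl(K) = ⟨[𝔮]⟩` for `𝔮 = (17, θ − 4)` by a pair-witness Minkowski sweep (`…ClassGroupCyclicCriterion`),
  hence `h_K = ord [𝔮]` — no class number is computed;
* L-SIDE (`capitulationIdentity_d4108n`): in ANY commutative ring with `g(B) = 0`, `s = B·e, e² = 50 + B + 5B² (= 2/B²; `e = s/θ` generates 𝓞 K₁ over ℤ[θ] together with 1)`, the identity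
  `(y) · (17, B − 4, s + 6) = (17) · (17, B − 4, s − 6)` for the explicit `y` below (six generator memberships, each a
  `linear_combination`; found by lattice reduction in `𝓞 K₁`), so the class of `I = (17, θ − 4, s − 6)` — a prime of `K₁` above `𝔮` — is
  `Gal(K₁/K)`-fixed with `N[I] = [𝔮]` (`…CapitulationCertificate`);
* `classNumberPExp_one_eq_zero_layer_d4108n`: the door `classNumberPExp_one_eq_classNumberPExp_zero_of_certificate` (one prime above `2`: Eisenstein model, `existsUnique_two_mem_adjoin_of_eisenstein`).

References: [Fukuda1994] Thm. 1 (1); [Lim2017FineSelmer] Thm. 3.5, Lemma 3.2; [Lang1990] Ch. 13 §4 Lemma 4.1; [Gras2003] II.6.2;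
[Marcus1977] Ch. 5 Thm. 37; [Cohen1993] §6.5.
-/

set_option autoImplicit false
-- sibling precedent (`…FukudaRowStampsE.lean`): the directory name repeats the summit name
set_option linter.dupNamespace false

noncomputable section

open scoped Classical IntermediateField NumberField Real nonZeroDivisors

namespace Summit.BirchSwinnertonDyer.BirchSwinnertonDyer.Theorems.AddKatoTwo

open WeierstrassCurve Field Polynomial IsDedekindDomain NumberField Literature.NumberTheory.EllipticCurves
  Literature.NumberTheory.GaloisRepresentations Literature.NumberTheory.IwasawaTheory Literature.NumberTheory.NumberFields
  Summit.BirchSwinnertonDyer.BirchSwinnertonDyer.Theses.ByReductionTypeAtTwo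

/-! ## §1 K-side: `Cl(K) = ⟨[𝔮]⟩` -/

section KSide

variable (K : Type) [Field K] [NumberField K]

/-- **`Cl(K) = ⟨[𝔮]⟩`, `𝔮 = (17, θ − 4)`, for every cubic number field whose integers contain a root `θ` of
`X³ + (0)X² + (10)X + (-2)`** (`|d_K| ≤ 4108`, `M_K < 19`): a pair-witness sweep over the primes `ℓ < 19` in the order
2, 3, 5, 7, 11, 13 — for each root `a` of the cubic mod `ℓ` an element of `(ℓ, θ − a)` of norm `ℓ · m` with `m` supported on
the primes treated before (listed in the proof). Consequently `h_K = ord [𝔮]` (no class number is computed). KERNEL.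
[cite: Marcus1977, Ch. 5 Thm. 37 and the class-group computations after Cor. 2] [cite: Cohen1993, §6.5] -/
theorem zpowers_mk0_eq_top_d4108n (h3 : Module.finrank ℚ K = 3) (b : 𝓞 K)
    (hb : b ^ 3 + (0 : ℤ) * b ^ 2 + (10 : ℤ) * b + (-2 : ℤ) = 0)
    (h0 : Ideal.span ({((17 : ℕ) : 𝓞 K), b - ((4 : ℕ) : 𝓞 K)} : Set (𝓞 K)) ∈ (Ideal (𝓞 K))⁰) :
    Subgroup.zpowers (ClassGroup.mk0 ⟨_, h0⟩) = ⊤ := by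
  have hirr := irreducible_cubic_d4108n
  have hd : |NumberField.discr K| ≤ (4108 : ℕ) :=
    le_trans (abs_discr_le_abs_cubic_discr K h3 b hirr hb) (by simp only [Cubic.discr]; norm_num)
  have hM := minkowskiBound_lt_of_sqrt_le K h3 hd (s := 64.10) (B := 19)
    ((Real.sqrt_le_sqrt (by norm_num : ((4108 : ℕ) : ℝ) ≤ (64.10 : ℝ) ^ 2)).trans (Real.sqrt_sq (by norm_num)).le) (by norm_num)
  set H : Subgroup (ClassGroup (𝓞 K)) := Subgroup.zpowers (ClassGroup.mk0 ⟨_, h0⟩) with hH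
  have hq : ClassIn H (Ideal.span ({((17 : ℕ) : 𝓞 K), b - ((4 : ℕ) : 𝓞 K)} : Set (𝓞 K))) := classIn_zpowers_self K _ h0
  have hS0 := forall_prime_above_nil K H
  -- `ℓ = 17`: roots [4], treated primes []
  have h_17 : ∀ P : Ideal (𝓞 K), P.IsPrime → P ≠ ⊥ → ((17 : ℕ) : 𝓞 K) ∈ P → ClassIn H P :=
    classIn_above_of_pairWitnesses K h3 b hirr hb (ℓ := 17) (by norm_num) (S := []) (by decide) hS0 (fun a ha hdvd => by
      interval_cases a <;> norm_num at hdvd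
      · exact Or.inl ⟨by norm_num, hq⟩)
  have hS1 := forall_prime_above_cons K h_17 hS0
  -- `ℓ = 2`: roots [0], treated primes [17]
  have h_2 : ∀ P : Ideal (𝓞 K), P.IsPrime → P ≠ ⊥ → ((2 : ℕ) : 𝓞 K) ∈ P → ClassIn H P :=
    classIn_above_of_pairWitnesses K h3 b hirr hb (ℓ := 2) (by norm_num) (S := [17]) (by decide) hS1 (fun a ha hdvd => by
      interval_cases a <;> norm_num at hdvd
      · exact Or.inr ⟨0, -1, 0, 1, 1, 0, [], by norm_num, by norm_num, ⟨_, by rw [Nat.cast_one, one_mul]⟩, by norm_num, by decide, by decide⟩)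
  have hS2 := forall_prime_above_cons K h_2 hS1
  -- `ℓ = 3`: roots [1], treated primes [2, 17]
  have h_3 : ∀ P : Ideal (𝓞 K), P.IsPrime → P ≠ ⊥ → ((3 : ℕ) : 𝓞 K) ∈ P → ClassIn H P :=
    classIn_above_of_pairWitnesses K h3 b hirr hb (ℓ := 3) (by norm_num) (S := [2, 17]) (by decide) hS2 (fun a ha hdvd => by
      interval_cases a <;> norm_num at hdvd
      · exact Or.inr ⟨-4, 1, 0, 1, 34, 1, [2, 17], by norm_num, by norm_num, ⟨_, by rw [Nat.cast_one, one_mul]⟩, by norm_num, by decide, by decide⟩)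
  have hS3 := forall_prime_above_cons K h_3 hS2
  -- `ℓ = 5`: roots [3], treated primes [3, 2, 17]
  have h_5 : ∀ P : Ideal (𝓞 K), P.IsPrime → P ≠ ⊥ → ((5 : ℕ) : 𝓞 K) ∈ P → ClassIn H P :=
    classIn_above_of_pairWitnesses K h3 b hirr hb (ℓ := 5) (by norm_num) (S := [3, 2, 17]) (by decide) hS3 (fun a ha hdvd => by
      interval_cases a <;> norm_num at hdvd
      · exact Or.inr ⟨1, 0, 1, 1, 17, 1, [17], by norm_num, by norm_num, ⟨_, by rw [Nat.cast_one, one_mul]⟩, by norm_num, by decide, by decide⟩)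
  have hS4 := forall_prime_above_cons K h_5 hS3
  -- `ℓ = 7`: roots [], treated primes [5, 3, 2, 17]
  have h_7 : ∀ P : Ideal (𝓞 K), P.IsPrime → P ≠ ⊥ → ((7 : ℕ) : 𝓞 K) ∈ P → ClassIn H P :=
    classIn_above_of_pairWitnesses K h3 b hirr hb (ℓ := 7) (by norm_num) (S := [5, 3, 2, 17]) (by decide) hS4 (fun a ha hdvd => by
      interval_cases a <;> norm_num at hdvd)
  have hS5 := forall_prime_above_cons K h_7 hS4
  -- `ℓ = 11`: roots [3], treated primes [7, 5, 3, 2, 17]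
  have h_11 : ∀ P : Ideal (𝓞 K), P.IsPrime → P ≠ ⊥ → ((11 : ℕ) : 𝓞 K) ∈ P → ClassIn H P :=
    classIn_above_of_pairWitnesses K h3 b hirr hb (ℓ := 11) (by norm_num) (S := [7, 5, 3, 2, 17]) (by decide) hS5 (fun a ha hdvd => by
      interval_cases a <;> norm_num at hdvd
      · exact Or.inr ⟨1, -1, -1, 1, 9, 2, [3], by norm_num, by norm_num, ⟨_, by rw [Nat.cast_one, one_mul]⟩, by norm_num, by decide, by decide⟩)
  have hS6 := forall_prime_above_cons K h_11 hS5
  -- `ℓ = 13`: roots [2, 12], treated primes [11, 7, 5, 3, 2, 17]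
  have h_13 : ∀ P : Ideal (𝓞 K), P.IsPrime → P ≠ ⊥ → ((13 : ℕ) : 𝓞 K) ∈ P → ClassIn H P :=
    classIn_above_of_pairWitnesses K h3 b hirr hb (ℓ := 13) (by norm_num) (S := [11, 7, 5, 3, 2, 17]) (by decide) hS6 (fun a ha hdvd => by
      interval_cases a <;> norm_num at hdvd
      · exact Or.inr ⟨2, -1, 0, 1, 2, 1, [2], by norm_num, by norm_num, ⟨_, by rw [Nat.cast_one, one_mul]⟩, by norm_num, by decide, by decide⟩
      · exact Or.inr ⟨-1, -1, 0, 1, 1, 0, [], by norm_num, by norm_num, ⟨_, by rw [Nat.cast_one, one_mul]⟩, by norm_num, by decide, by decide⟩)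
  have hS7 := forall_prime_above_cons K h_13 hS6
  exact subgroup_eq_top_of_forall_prime_lt K h3 hM (forall_prime_lt_of_forall_mem K (S := [13, 11, 7, 5, 3, 2, 17]) (by decide) hS7)

end KSide

/-! ## §2 L-side: the ideal identity in `𝓞 K₁` -/

/-- **The capitulation identity for `98592q1`**: in any commutative ring with `B³ + (0)B² + (10)B + (-2) = 0` and `s = B·e, e² = 50 + B + 5B² (= 2/B²; `e = s/θ` generates 𝓞 K₁ over ℤ[θ] together with 1)`,
`(y) · (17, B − 4, s + 6) = (17) · (17, B − 4, s − 6)` for the displayed `y` (coefficients found by LLL in the order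
`ℤ[θ] ⊕ ℤ[θ]·(s/θ)` of `K₁ = ℚ(θ, √2)`; each membership is a polynomial identity modulo the two relations). KERNEL.
[cite: Gras2003, II.6.2 (ambiguous ideal classes)] [cite: Cohen2000, §2.3] -/
theorem capitulationIdentity_d4108n {R : Type} [CommRing R] (B E : R)
    (hB : B ^ 3 + ((0 : ℤ) : R) * B ^ 2 + ((10 : ℤ) : R) * B + ((-2 : ℤ) : R) = 0) (hE : E ^ 2 = ((50 : ℤ) : R) + ((1 : ℤ) : R) * B + ((5 : ℤ) : R) * B ^ 2) :
    ∃ y : R, (∃ u v w : R, y * ((17 : ℕ) : R) = ((17 : ℕ) : R) * (u * ((17 : ℕ) : R) + v * (B - ((4 : ℕ) : R)) + w * (B * E - ((6 : ℤ) : R)))) ∧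
      (∃ u v w : R, y * (B - ((4 : ℕ) : R)) = ((17 : ℕ) : R) * (u * ((17 : ℕ) : R) + v * (B - ((4 : ℕ) : R)) + w * (B * E - ((6 : ℤ) : R)))) ∧
      (∃ u v w : R, y * (B * E + ((6 : ℤ) : R)) = ((17 : ℕ) : R) * (u * ((17 : ℕ) : R) + v * (B - ((4 : ℕ) : R)) + w * (B * E - ((6 : ℤ) : R)))) ∧
      (∃ u v w : R, ((17 : ℕ) : R) * ((17 : ℕ) : R) = y * (u * ((17 : ℕ) : R) + v * (B - ((4 : ℕ) : R)) + w * (B * E + ((6 : ℤ) : R)))) ∧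
      (∃ u v w : R, ((17 : ℕ) : R) * (B - ((4 : ℕ) : R)) = y * (u * ((17 : ℕ) : R) + v * (B - ((4 : ℕ) : R)) + w * (B * E + ((6 : ℤ) : R)))) ∧
      (∃ u v w : R, ((17 : ℕ) : R) * (B * E - ((6 : ℤ) : R)) = y * (u * ((17 : ℕ) : R) + v * (B - ((4 : ℕ) : R)) + w * (B * E + ((6 : ℤ) : R)))) := by
  refine ⟨((1 : ℤ) : R) + ((5 : ℤ) : R) * E + ((-9 : ℤ) : R) * B + ((-28 : ℤ) : R) * B * E + ((2 : ℤ) : R) * B ^ 2 + ((10 : ℤ) : R) * B ^ 2 * E, ?_, ?_, ?_, ?_, ?_, ?_⟩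
  · exact ⟨((-1 : ℤ) : R) + ((1 : ℤ) : R) * E + ((-1 : ℤ) : R) * B + ((-1 : ℤ) : R) * B * E + ((1 : ℤ) : R) * B ^ 2 * E, (0 : R), ((1 : ℤ) : R) + ((2 : ℤ) : R) * E + ((-1 : ℤ) : R) * B + ((2 : ℤ) : R) * B * E + ((1 : ℤ) : R) * B ^ 2 * E, by push_cast; linear_combination (((-204 : ℤ) : R) + ((-187 : ℤ) : R) * B + ((-85 : ℤ) : R) * B ^ 2) * hB + (((-34 : ℤ) : R) * B + ((-34 : ℤ) : R) * B ^ 2 + ((-17 : ℤ) : R) * B ^ 3) * hE⟩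
  · exact ⟨((1 : ℤ) : R) * B * E, ((1 : ℤ) : R) + ((-1 : ℤ) : R) * B + ((1 : ℤ) : R) * B * E, ((1 : ℤ) : R) * B + ((2 : ℤ) : R) * B * E + ((1 : ℤ) : R) * B ^ 2 * E, by push_cast; linear_combination (((-32 : ℤ) : R) + ((10 : ℤ) : R) * E + ((-187 : ℤ) : R) * B + ((-85 : ℤ) : R) * B ^ 2) * hB + (((-34 : ℤ) : R) * B ^ 2 + ((-17 : ℤ) : R) * B ^ 3) * hE⟩
  · exact ⟨((-1 : ℤ) : R) * B * E, ((2 : ℤ) : R) + ((-1 : ℤ) : R) * E + ((1 : ℤ) : R) * B + ((-1 : ℤ) : R) * B * E + ((-1 : ℤ) : R) * B ^ 2 * E, ((-1 : ℤ) : R) + ((1 : ℤ) : R) * B * E, by push_cast; linear_combination (((-20 : ℤ) : R) + ((19 : ℤ) : R) * E + ((-215 : ℤ) : R) * B + ((50 : ℤ) : R) * B ^ 2) * hB + (((5 : ℤ) : R) * B + ((-45 : ℤ) : R) * B ^ 2 + ((10 : ℤ) : R) * B ^ 3) * hE⟩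
  · exact ⟨((7 : ℤ) : R) + ((-3 : ℤ) : R) * E + ((-1 : ℤ) : R) * B * E + ((1 : ℤ) : R) * B ^ 2, ((-2 : ℤ) : R) + ((3 : ℤ) : R) * E + ((-2 : ℤ) : R) * B + ((1 : ℤ) : R) * B * E, ((3 : ℤ) : R) + ((3 : ℤ) : R) * E + ((2 : ℤ) : R) * B * E + ((-1 : ℤ) : R) * B ^ 2 * E, by push_cast; linear_combination (((-5697 : ℤ) : R) + ((340 : ℤ) : R) * E + ((1953 : ℤ) : R) * B + ((261 : ℤ) : R) * B * E + ((-448 : ℤ) : R) * B ^ 2 + ((107 : ℤ) : R) * B ^ 2 * E + ((187 : ℤ) : R) * B ^ 3 + ((-230 : ℤ) : R) * B ^ 3 * E + ((10 : ℤ) : R) * B ^ 4 + ((50 : ℤ) : R) * B ^ 4 * E) * hB + (((225 : ℤ) : R) + ((-1248 : ℤ) : R) * B + ((-15 : ℤ) : R) * B * E + ((416 : ℤ) : R) * B ^ 2 + ((74 : ℤ) : R) * B ^ 2 * E + ((-97 : ℤ) : R) * B ^ 3 + ((31 : ℤ) : R) * B ^ 3 * E + ((37 : ℤ) : R) * B ^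 4 + ((-48 : ℤ) : R) * B ^ 4 * E + ((2 : ℤ) : R) * B ^ 5 + ((10 : ℤ) : R) * B ^ 5 * E) * hE⟩
  · exact ⟨((-2 : ℤ) : R), ((1 : ℤ) : R) + ((-1 : ℤ) : R) * E + ((1 : ℤ) : R) * B + ((-1 : ℤ) : R) * B * E + ((1 : ℤ) : R) * B ^ 2 * E, ((-2 : ℤ) : R) + ((1 : ℤ) : R) * E + ((-1 : ℤ) : R) * B ^ 2 + ((1 : ℤ) : R) * B ^ 2 * E, by push_cast; linear_combination (((1259 : ℤ) : R) + ((-120 : ℤ) : R) * E + ((-315 : ℤ) : R) * B + ((173 : ℤ) : R) * B * E + ((74 : ℤ) : R) * B ^ 2 + ((-47 : ℤ) : R) * B ^ 2 * E + ((-7 : ℤ) : R) * B ^ 3 + ((130 : ℤ) : R) * B ^ 3 * E + ((-10 : ℤ) : R) * B ^ 4 + ((-50 : ℤ) : R) * B ^ 4 * E) * hB + (((-50 : ℤ) : R) + ((274 : ℤ) : R) * B + ((-5 : ℤ) : R) * B * E + ((-68 : ℤ) : R) * B ^ 2 + ((28 : ℤ) : R) * B ^ 2 * E + ((15 : ℤ)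 : R) * B ^ 3 + ((-15 : ℤ) : R) * B ^ 3 * E + ((-1 : ℤ) : R) * B ^ 4 + ((28 : ℤ) : R) * B ^ 4 * E + ((-2 : ℤ) : R) * B ^ 5 + ((-10 : ℤ) : R) * B ^ 5 * E) * hE⟩
  · exact ⟨((-4 : ℤ) : R) + ((2 : ℤ) : R) * E + ((-1 : ℤ) : R) * B * E, ((-1 : ℤ) : R) * B + ((-1 : ℤ) : R) * B * E + ((-1 : ℤ) : R) * B ^ 2 * E, ((-2 : ℤ) : R) * E + ((-1 : ℤ) : R) * B + ((-1 : ℤ) : R) * B * E + ((-1 : ℤ) : R) * B ^ 2, by push_cast; linear_combination (((2767 : ℤ) : R) + ((-159 : ℤ) : R) * E + ((-3630 : ℤ) : R) * B + ((-215 : ℤ) : R) * B * E + ((1181 : ℤ) : R) * B ^ 2 + ((-26 : ℤ) : R) * B ^ 2 * E + ((-350 : ℤ) : R) * B ^ 3 + ((50 : ℤ) : R) * B ^ 3 * E + ((100 : ℤ) : R) * B ^ 4) * hB + (((-110 : ℤ) : R) + ((713 : ℤ) : R) * B + ((10 : ℤ) : R) * B * E + ((-779 : ℤ) : R) * B ^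 2 + ((-51 : ℤ) : R) * B ^ 2 * E + ((251 : ℤ) : R) * B ^ 3 + ((-8 : ℤ) : R) * B ^ 3 * E + ((-74 : ℤ) : R) * B ^ 4 + ((10 : ℤ) : R) * B ^ 4 * E + ((20 : ℤ) : R) * B ^ 5) * hE⟩

/-! ## §3 The displayed hypothesis `e₁ = e₀` discharged, and the census stamp -/

/-- **`e₁ = e₀` along the cyclotomic `ℤ₂`-tower of `ℚ(θ)`**, `θ` any root of `X³ + (0)X² + (10)X + (-2)` — the displayed hypothesis
`h01` of `conjA_two_98592q1_of_fukudaLayers`, now KERNEL: §1 (`h_K = ord [𝔮]`), §2 (the ambiguous class above `𝔮`), and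
the door `classNumberPExp_one_eq_classNumberPExp_zero_of_certificate` (one prime above `2`: Eisenstein model, `existsUnique_two_mem_adjoin_of_eisenstein`).
[cite: Lang1990, Ch. 13 §4, Lemma 4.1] [cite: Gras2003, II.6.2.3] [cite: Fukuda1994, Thm. 1 (1), p. 264] -/
theorem classNumberPExp_one_eq_zero_layer_d4108n {θ : AlgebraicClosure ℚ}
    (hθ : aeval θ (Cubic.toPoly ⟨1, ((0 : ℤ) : ℚ), ((10 : ℤ) : ℚ), ((-2 : ℤ) : ℚ)⟩) = 0) :
    haveI : FiniteDimensional ℚ (IntermediateField.adjoin ℚ {θ}) :=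
      IntermediateField.adjoin.finiteDimensional ((AlgebraicClosure.isAlgebraic ℚ).isAlgebraic θ).isIntegral
    haveI : NumberField (IntermediateField.adjoin ℚ {θ}) := NumberField.mk
    ∀ κL : ZpExtension (IntermediateField.adjoin ℚ {θ}) 2, κL.IsCyclotomic → classNumberPExp κL 1 = classNumberPExp κL 0 := by
  haveI : FiniteDimensional ℚ (IntermediateField.adjoin ℚ {θ}) :=
    IntermediateField.adjoin.finiteDimensional ((AlgebraicClosure.isAlgebraic ℚ).isAlgebraic θ).isIntegral
  haveI : NumberField (IntermediateField.adjoin ℚ {θ}) := NumberField.mk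
  intro κL hκL
  have hirr := irreducible_cubic_d4108n
  have h3 := finrank_adjoin_eq_three_of_irreducible hirr hθ
  obtain ⟨b, -, hb⟩ := exists_ringOfIntegers_cubic_root (p := 0) (q := 10) (r := -2) hθ
  have hs1 := ncard_primes_above_two_le_one_of_existsUnique (existsUnique_two_mem_adjoin_of_eisenstein (p := 0) (q := 10) (r := -2) (by decide) (by decide) (by decide) (by decide) hθ)
  have h0 : Ideal.span ({((17 : ℕ) : 𝓞 (IntermediateField.adjoin ℚ {θ})), b - ((4 : ℕ) : 𝓞 (IntermediateField.adjoin ℚ {θ}))} : Set _) ∈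
      (Ideal (𝓞 (IntermediateField.adjoin ℚ {θ})))⁰ := by
    refine mem_nonZeroDivisors_of_ne_zero fun h => ?_
    have hmem : ((17 : ℕ) : 𝓞 (IntermediateField.adjoin ℚ {θ})) ∈
        Ideal.span ({((17 : ℕ) : 𝓞 (IntermediateField.adjoin ℚ {θ})), b - ((4 : ℕ) : 𝓞 (IntermediateField.adjoin ℚ {θ}))} : Set _) :=
      Ideal.subset_span (by simp)
    rw [h] at hmem
    exact absurd (Nat.cast_eq_zero.mp ((Submodule.mem_bot _).mp hmem)) (by norm_num)
  refine classNumberPExp_one_eq_classNumberPExp_zero_of_certificate (by rw [h3]; decide) κL hκL hs1 (n := 17) (by norm_num) h0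
      (zpowers_mk0_eq_top_d4108n _ h3 b hb h0) (t := 6) (w := 2) (u := 1) (v := -8) (a := -7) (c := 5)
      (by norm_num) (by norm_num) (by norm_num) ?_
  intro L _ _ _ s hs
  have hB : (algebraMap _ (𝓞 L) b) ^ 3 + ((0 : ℤ) : 𝓞 L) * (algebraMap _ (𝓞 L) b) ^ 2 +
      ((10 : ℤ) : 𝓞 L) * (algebraMap _ (𝓞 L) b) + ((-2 : ℤ) : 𝓞 L) = 0 := by
    simpa only [map_add, map_mul, map_pow, map_intCast, map_zero] using
      congrArg (algebraMap (𝓞 (IntermediateField.adjoin ℚ {θ})) (𝓞 L)) hb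
  have hπ0 : (algebraMap _ (𝓞 L) b) ≠ 0 := by
    intro h
    rw [h] at hB
    norm_num at hB
  have hπc : (algebraMap _ (𝓞 L) b) ^ 2 * (((50 : ℤ) : 𝓞 L) + ((1 : ℤ) : 𝓞 L) * (algebraMap _ (𝓞 L) b) + ((5 : ℤ) : 𝓞 L) * (algebraMap _ (𝓞 L) b) ^ 2) = 2 := by linear_combination (((5 : ℤ) : 𝓞 L) * (algebraMap _ (𝓞 L) b) + 1) * hB
  obtain ⟨E, hsE, hE⟩ := exists_eq_mul_and_sq_eq s _ _ hs hπc hπ0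
  obtain ⟨y, h1, h2, h3, h4, h5, h6⟩ := capitulationIdentity_d4108n _ E hB hE
  rw [map_sub, map_natCast, hsE]
  exact ⟨y, ((17 : ℕ) : 𝓞 L), Nat.cast_ne_zero.mpr (by norm_num), h1, h2, h3, h4, h5, h6⟩

/-- **(A)₂ FOR `98592q1` MODULO `hLim2` ALONE — no displayed datum left.** The Fukuda-row stamp `conjA_two_98592q1_of_fukudaLayers` (k4-w1 GEN 5)
with its displayed hypothesis `e₁ = e₀` supplied by `classNumberPExp_one_eq_zero_layer_d4108n` (KERNEL: class-group certificate for `ℚ(θ)`,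
capitulation certificate in `ℚ(θ, √2)`, Chevalley's ambiguous class number formula, Fukuda 1994 Thm. 1 (1)). Conditional on `hLim2`
(Lim 2017 Thm. 3.5 at `2`) BY NAME; BSD is not proved by this. [cite: Lim2017FineSelmer, §3 Thm. 3.5 and Lemma 3.2]
[cite: Fukuda1994, Thm. 1 (1), p. 264] [cite: Lang1990, Ch. 13 §4, Lemma 4.1] -/
theorem conjA_two_98592q1
    (hLim2 : Lim2017.thm35_at_two_fineSelmerDual_moduleFinite_of_classicalMuVanishes_of_le_divisionField_four)
    {θ : AlgebraicClosure ℚ} (hθ : aeval θ (Cubic.toPoly ⟨1, ((0 : ℤ) : ℚ), ((10 : ℤ) : ℚ), ((-2 : ℤ) : ℚ)⟩) = 0)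
    (κ : ZpExtension ℚ 2) (hκ : κ.IsCyclotomic) :
    haveI := isElliptic_98592q1'
    ∃ (γ : absoluteGaloisGroup ℚ) (D : (⟨0, ((-1 : ℤ) : ℚ), 0, ((-195347181 : ℤ) : ℚ), ((-1770320388987 : ℤ) : ℚ)⟩ : WeierstrassCurve ℚ).FineSelmerDualData κ γ),
      Module.Finite ℤ_[2] (RestrictScalars ℤ_[2] (IwasawaAlgebra 2) D.X) :=
  conjA_two_98592q1_of_fukudaLayers hLim2 hθ (classNumberPExp_one_eq_zero_layer_d4108n hθ) κ hκ

end Summit.BirchSwinnertonDyer.BirchSwinnertonDyer.Theorems.AddKatoTwo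

end
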